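import Mathlib
import Literature.GroupTheory.PermutationGroups.SmallIndexSubgroups
import Literature.GroupTheory.PermutationGroups.SmallIndexSubgroupsAlternating
import Summits.ValiantsHypothesis.ValiantsHypothesis.Theorems.MonotoneRestorationOrbitRestorationQPRankDistance
import Summits.ValiantsHypothesis.ValiantsHypothesis.Theorems.MonotoneRestorationOrbitRestorationQPHomogTools
import Summits.ValiantsHypothesis.ValiantsHypothesis.Theorems.MonotoneRestorationOrbitRestorationQPValueDerivation
import HarnessLib

/-!
# Supports for row and column actions (small orbits ⇒ rigid supports, for a general variable action; ORBIT currency)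

Route MonotoneRestoration, crux `OrbitRestorationQP` (stmt-ValiantsHypothesis-18293), line `depth-three-rung`, registered stub
`stub_sigmaPiSigmaKValue` (A_k).  Namespace `Summit.ValiantsHypothesis.ValiantsHypothesis.Theorems.ProductAction`.  Route-independent.

The group tools of `…ValueSupport.lean` (orbit ⇒ alternating support by Dixon–Mortimer 5.2B; a stable LINE is fixed, by perfectness of
`A_m`; affine upgrade) are stated there for the DIAGONAL action `ren`.  The structure theorem behind `stub_sigmaPiSigmaKValue` (crux workfile
`Lines/depth-three-rung-stubA-bounded-fanin.md` §2 (c),(f)) needs them for the ROW and COLUMN actions of `Sym(Fin n)` on the `n × n`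
matrix (matrix symmetry = invariance under `Sym(Fin n) × Sym(Fin n)`).  This file proves them once for an ARBITRARY action
`A : Perm (Fin n) →* (K[V] ≃ₐ[K] K[V])` by algebra automorphisms:

* `index_le_ncard_range` — orbit–stabiliser as an inequality;
* `altFix_of_ncard_lt` / `altFixLine_of_ncard_lt` — a polynomial (resp. a LINE, i.e. a polynomial up to units, tracked by its
  normal form `RankDistance.nrm`) with fewer than `C(n,k)` images is fixed (resp. fixed up to a unit) by every even permutation fixing
  pointwise a set of fewer than `k` indices [Dixon–Mortimer 5.2B, tree `alternating_fixing_le_of_index_lt_choose`];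
* `fix_of_fixLine` — a line stable under the even pointwise stabiliser is fixed by it (perfectness, `commutator_alternatingGroup_eq_top`);
* `vact g` — the action `rename (g ρ)` of a homomorphism `g : Perm (Fin n) →* Perm (Fin n × Fin n)`; `rowHom`, `colHom`; the affine
  upgrade `symFix_of_altFix_affine` for LOCAL `g` (a transposition away from the coordinates of a position does not move it), and the
  dictionary with matrix symmetry (`rename_prod_eq`) and with the diagonal `ren` (`ren_eq_row_col`);
* `eq_one_or_eq_neg_one` — a multiplicative character of `Sym(Fin n)` takes only the values `±1`.

Everything is proved. [folklore; cite: DixonMortimer1996, Thm 5.2B; DawarWilsenach2025, Def. 6.1]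
-/

noncomputable section

open MvPolynomial Equiv Literature.GroupTheory.PermutationGroups

-- `Summit.ValiantsHypothesis.ValiantsHypothesis.…` is the tree's single-conjunct layout (Sub = Summit).
set_option linter.dupNamespace false

namespace Summit.ValiantsHypothesis.ValiantsHypothesis.Theorems

namespace ProductAction

open RankDistance

variable {n : ℕ} {K : Type} [Field K] {V : Type}

/-! ### Orbit–stabiliser as an inequality -/

/-- If `f a = f b` forces `a⁻¹ b ∈ S`, then `S` has index at most the number of values of `f`. [folklore] -/
theorem index_le_ncard_range {G : Type*} [Group G] (S : Subgroup G) {β : Type*} (f : G → β)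
    (hf : ∀ a b, f a = f b → a⁻¹ * b ∈ S) (hfin : (Set.range f).Finite) : S.index ≤ (Set.range f).ncard := by
  classical
  let F : G ⧸ S → Set.range f := fun c => ⟨f c.out, c.out, rfl⟩
  have hF : Function.Injective F := by
    intro a b hab
    have hab' : f a.out = f b.out := congrArg Subtype.val hab
    rw [← QuotientGroup.out_eq' a, ← QuotientGroup.out_eq' b, QuotientGroup.eq]
    exact hf _ _ hab'
  haveI : Finite (Set.range f) := hfin.to_subtype
  have := Nat.card_le_card_of_injective F hF
  rwa [Nat.card_coe_set_eq] at this

/-! ### An abstract action by algebra automorphisms -/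

variable (A : Perm (Fin n) →* (MvPolynomial V K ≃ₐ[K] MvPolynomial V K))

/-- The stabiliser of a polynomial. [folklore] -/
def stab (F : MvPolynomial V K) : Subgroup (Perm (Fin n)) where
  carrier := {ρ | A ρ F = F}
  mul_mem' := by
    intro a b ha hb
    simp only [Set.mem_setOf_eq] at ha hb ⊢
    rw [map_mul, AlgEquiv.mul_apply, hb, ha]
  one_mem' := by simp
  inv_mem' := by
    intro a ha
    simp only [Set.mem_setOf_eq] at ha ⊢
    conv_lhs => rw [← ha]
    rw [← AlgEquiv.mul_apply, ← map_mul, inv_mul_cancel, map_one, AlgEquiv.one_apply]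

/-- The stabiliser of the LINE through a polynomial (the polynomial up to units). [folklore] -/
def lineStab (q : MvPolynomial V K) : Subgroup (Perm (Fin n)) where
  carrier := {ρ | Associated (A ρ q) q}
  mul_mem' := by
    intro a b ha hb
    simp only [Set.mem_setOf_eq] at ha hb ⊢
    rw [map_mul, AlgEquiv.mul_apply]
    exact (hb.map (A a)).trans ha
  one_mem' := by simp
  inv_mem' := by
    intro a ha
    simp only [Set.mem_setOf_eq] at ha ⊢
    have := ha.symm.map (A a⁻¹)
    rwa [← AlgEquiv.mul_apply, ← map_mul, inv_mul_cancel, map_one, AlgEquiv.one_apply] at this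

/-- **Small orbit ⇒ alternating support** for an abstract action: a polynomial with fewer than `C(n,k)` images (`n > 8`, `1 ≤ k`,
`4k ≤ n`) is fixed by every even permutation fixing pointwise some set of fewer than `k` indices. [cite: DixonMortimer1996, Thm 5.2B] -/
theorem altFix_of_ncard_lt {k : ℕ} (hn : 8 < n) (hk : 1 ≤ k) (h4k : 4 * k ≤ n) (F : MvPolynomial V K)
    (hfin : (Set.range fun ρ : Perm (Fin n) => A ρ F).Finite)
    (hF : (Set.range fun ρ : Perm (Fin n) => A ρ F).ncard < n.choose k) :
    ∃ Y : Finset (Fin n), Y.card < k ∧ ∀ ρ : Perm (Fin n), (∀ x ∈ Y, ρ x = x) → Perm.sign ρ = 1 → A ρ F = F := by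
  have hidx : (stab A F).index < (Fintype.card (Fin n)).choose k := by
    rw [Fintype.card_fin]
    refine lt_of_le_of_lt (index_le_ncard_range _ _ (fun a b hab => ?_) hfin) hF
    show A (a⁻¹ * b) F = F
    have hab' : A a F = A b F := hab
    rw [map_mul, AlgEquiv.mul_apply, ← hab', ← AlgEquiv.mul_apply, ← map_mul, inv_mul_cancel, map_one, AlgEquiv.one_apply]
  obtain ⟨Y, hYk, hY⟩ := alternating_fixing_le_of_index_lt_choose (stab A F) k (by rwa [Fintype.card_fin]) hk
    (by rwa [Fintype.card_fin]) hidx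
  exact ⟨Y, hYk, fun ρ hρ hs => hY ρ hρ hs⟩

/-- **Small orbit of a LINE ⇒ alternating support up to units**: if the normal forms `nrm (A ρ q)` take fewer than `C(n,k)` values,
then every even permutation fixing pointwise some set of fewer than `k` indices maps `q` to an associate. [cite: DixonMortimer1996, Thm 5.2B] -/
theorem altFixLine_of_ncard_lt {k : ℕ} (hn : 8 < n) (hk : 1 ≤ k) (h4k : 4 * k ≤ n) (q : MvPolynomial V K)
    (hfin : (Set.range fun ρ : Perm (Fin n) => nrm (A ρ q)).Finite)
    (hq : (Set.range fun ρ : Perm (Fin n) => nrm (A ρ q)).ncard < n.choose k) :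
    ∃ Y : Finset (Fin n), Y.card < k ∧
      ∀ ρ : Perm (Fin n), (∀ x ∈ Y, ρ x = x) → Perm.sign ρ = 1 → Associated (A ρ q) q := by
  have hidx : (lineStab A q).index < (Fintype.card (Fin n)).choose k := by
    rw [Fintype.card_fin]
    refine lt_of_le_of_lt (index_le_ncard_range _ _ (fun a b hab => ?_) hfin) hq
    show Associated (A (a⁻¹ * b) q) q
    have hab' : Associated (A a q) (A b q) := associated_of_nrm_eq hab
    have := hab'.symm.map (A a⁻¹)
    rwa [← AlgEquiv.mul_apply, ← AlgEquiv.mul_apply, ← map_mul, ← map_mul, inv_mul_cancel, map_one,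
      AlgEquiv.one_apply] at this
  obtain ⟨Y, hYk, hY⟩ := alternating_fixing_le_of_index_lt_choose (lineStab A q) k (by rwa [Fintype.card_fin]) hk
    (by rwa [Fintype.card_fin]) hidx
  exact ⟨Y, hYk, fun ρ hρ hs => hY ρ hρ hs⟩

/-- **A line stable under the even pointwise stabiliser is fixed by it** (perfectness of `Alt(Fin n ∖ Y)`, `|Y| + 5 ≤ n`; the proof
follows `ValueSupport.fixes_of_fixesLine`). [folklore] -/
theorem fix_of_fixLine {Y : Finset (Fin n)} (h5 : Y.card + 5 ≤ n) {q : MvPolynomial V K} (hq : q ≠ 0)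
    (hline : ∀ ρ : Perm (Fin n), (∀ x ∈ Y, ρ x = x) → Perm.sign ρ = 1 → Associated (A ρ q) q) :
    ∀ ρ : Perm (Fin n), (∀ x ∈ Y, ρ x = x) → Perm.sign ρ = 1 → A ρ q = q := by
  classical
  -- scalars
  have hline' : ∀ ρ : Perm (Fin n), (∀ x ∈ Y, ρ x = x) → Perm.sign ρ = 1 → ∃ u : K, A ρ q = C u * q := by
    intro ρ hρ hs
    obtain ⟨w, hw⟩ := (hline ρ hρ hs).symm
    obtain ⟨u, -, hu⟩ := MvPolynomial.isUnit_iff_eq_C_of_isReduced.1 w.isUnit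
    exact ⟨u, by rw [← hw, hu, mul_comm]⟩
  let G := alternatingGroup {x : Fin n // x ∉ Y}
  let ι : G → Perm (Fin n) := fun g => Perm.ofSubtype (g : Perm {x : Fin n // x ∉ Y})
  have hιmul : ∀ g h : G, ι (g * h) = ι g * ι h := fun g h => by
    simp only [ι, Subgroup.coe_mul, map_mul]
  have hιfix : ∀ g : G, ∀ x ∈ Y, ι g x = x := fun g x hx => ofSubtype_alternatingGroup_apply_of_mem Y g hx
  have hιsign : ∀ g : G, Perm.sign (ι g) = 1 := fun g => sign_ofSubtype_alternatingGroup Y g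
  choose u hu using fun g : G => hline' (ι g) (hιfix g) (hιsign g)
  have hC : ∀ (ρ : Perm (Fin n)) (c : K), A ρ (C c) = C c := fun ρ c => by
    rw [← MvPolynomial.algebraMap_eq]; exact (A ρ).commutes c
  have hinj : ∀ ρ : Perm (Fin n), Function.Injective (A ρ) := fun ρ => (A ρ).injective
  have hu0 : ∀ g : G, u g ≠ 0 := by
    intro g hg
    have : A (ι g) q = 0 := by rw [hu g, hg, C_0, zero_mul]
    exact hq (hinj (ι g) (by rw [this, map_zero]))
  have hu1 : u 1 = 1 := by
    have h := hu 1
    rw [show ι 1 = 1 from by simp [ι], map_one, AlgEquiv.one_apply] at h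
    have h' : C (u 1) * q = C 1 * q := by rw [← h, C_1, one_mul]
    exact C_injective _ _ (mul_right_cancel₀ hq h')
  have humul : ∀ g h : G, u (g * h) = u g * u h := by
    intro g h
    have e1 : A (ι (g * h)) q = C (u g * u h) * q := by
      rw [hιmul, map_mul, AlgEquiv.mul_apply, hu h, map_mul, hC, hu g, map_mul]; ring
    have e2 := hu (g * h)
    rw [e2] at e1
    exact C_injective _ _ (mul_right_cancel₀ hq e1)
  let χ : G →* Kˣ :=
    { toFun := fun g => Units.mk0 (u g) (hu0 g)
      map_one' := Units.ext (by simp [hu1])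
      map_mul' := fun g h => Units.ext (by simp [humul]) }
  have hcard : 5 ≤ Nat.card {x : Fin n // x ∉ Y} := by
    rw [Nat.card_eq_fintype_card, Fintype.card_subtype_compl, Fintype.card_fin, Fintype.card_coe]
    omega
  have hker : ∀ g : G, χ g = 1 := by
    intro g
    have hg : g ∈ χ.ker := by
      have h1 : commutator G ≤ χ.ker := Abelianization.commutator_subset_ker χ
      rw [commutator_alternatingGroup_eq_top hcard] at h1
      exact h1 (Subgroup.mem_top g)
    exact hg
  have hug : ∀ g : G, u g = 1 := fun g => by
    have := congrArg (fun z : Kˣ => (z : K)) (hker g)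
    simpa [χ] using this
  intro ρ hρ hsign
  obtain ⟨g, hg⟩ := exists_alternatingGroup_ofSubtype_eq Y ρ hρ hsign
  have := hu g
  rw [hug g, C_1, one_mul] at this
  rw [← hg]; exact this

/-! ### Variable actions on the matrix positions -/

/-- The action on polynomials of a homomorphism into the permutations of the positions: `ρ ↦ rename (g ρ)`. [folklore] -/
def vact {Y : Type} (g : Perm (Fin n) →* Perm Y) : Perm (Fin n) →* (MvPolynomial Y K ≃ₐ[K] MvPolynomial Y K) where
  toFun ρ := renameEquiv K (g ρ)
  map_one' := by
    ext p : 1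
    simp [renameEquiv]
  map_mul' a b := by
    ext p : 1
    simp only [map_mul, AlgEquiv.mul_apply, renameEquiv_apply]
    rw [rename_rename]
    rfl

/-- `vact g ρ p = rename (g ρ) p`. [folklore] -/
@[simp] theorem vact_apply {Y : Type} (g : Perm (Fin n) →* Perm Y) (ρ : Perm (Fin n)) (p : MvPolynomial Y K) :
    vact (K := K) g ρ p = rename (g ρ) p := rfl

/-- The ROW action `σ ↦ ((p, q) ↦ (σ p, q))`. [folklore] -/
def rowHom : Perm (Fin n) →* Perm (Fin n × Fin n) where
  toFun σ := Equiv.prodCongr σ (Equiv.refl _)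
  map_one' := by ext ⟨p, q⟩ <;> rfl
  map_mul' a b := by ext ⟨p, q⟩ <;> rfl

/-- The COLUMN action `τ ↦ ((p, q) ↦ (p, τ q))`. [folklore] -/
def colHom : Perm (Fin n) →* Perm (Fin n × Fin n) where
  toFun τ := Equiv.prodCongr (Equiv.refl _) τ
  map_one' := by ext ⟨p, q⟩ <;> rfl
  map_mul' a b := by ext ⟨p, q⟩ <;> rfl

/-- `rowHom σ (p, q) = (σ p, q)`. [folklore] -/
@[simp] theorem rowHom_apply (σ : Perm (Fin n)) (v : Fin n × Fin n) : rowHom σ v = (σ v.1, v.2) := rfl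

/-- `colHom τ (p, q) = (p, τ q)`. [folklore] -/
@[simp] theorem colHom_apply (τ : Perm (Fin n)) (v : Fin n × Fin n) : colHom τ v = (v.1, τ v.2) := rfl

/-- **Dictionary with matrix symmetry**: the independent row/column renaming is the row action after the column action. [folklore] -/
theorem rename_prod_eq (σ τ : Perm (Fin n)) (f : MvPolynomial (Fin n × Fin n) K) :
    rename (fun p : Fin n × Fin n => (σ p.1, τ p.2)) f = vact (K := K) rowHom σ (vact (K := K) colHom τ f) := by
  rw [vact_apply, vact_apply, rename_rename]
  rfl

/-- **Dictionary with the diagonal action**: `ren ρ = row ρ ∘ col ρ`. [folklore] -/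
theorem ren_eq_row_col (ρ : Perm (Fin n)) (f : MvPolynomial (Fin n × Fin n) K) :
    ren ρ f = vact (K := K) rowHom ρ (vact (K := K) colHom ρ f) := by
  rw [← rename_prod_eq]
  rfl

/-- LOCALITY of a position action: a transposition of two indices away from the coordinates of a position does not move it. [folklore] -/
def IsLocal (g : Perm (Fin n) →* Perm (Fin n × Fin n)) : Prop :=
  ∀ (ρ : Perm (Fin n)) (a b : Fin n) (v : Fin n × Fin n),
    a ≠ v.1 → a ≠ v.2 → b ≠ v.1 → b ≠ v.2 → g (ρ * swap a b) v = g ρ v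

/-- The row action is local. [folklore] -/
theorem isLocal_rowHom : IsLocal (rowHom (n := n)) := by
  intro ρ a b v ha _ hb _
  simp only [rowHom_apply, Perm.mul_apply, Prod.mk.injEq, and_true]
  rw [swap_apply_of_ne_of_ne (Ne.symm ha) (Ne.symm hb)]

/-- The column action is local. [folklore] -/
theorem isLocal_colHom : IsLocal (colHom (n := n)) := by
  intro ρ a b v _ ha _ hb
  simp only [colHom_apply, Perm.mul_apply, Prod.mk.injEq, true_and]
  rw [swap_apply_of_ne_of_ne (Ne.symm ha) (Ne.symm hb)]

/-- Renaming an affine normal form by a permutation of the positions permutes the coefficients. [folklore] -/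
theorem rename_affine (e : Perm (Fin n × Fin n)) (c₀ : K) (c : Fin n × Fin n → K) :
    rename e (C c₀ + ∑ v, C (c v) * X v) = C c₀ + ∑ v, C (c (e.symm v)) * X v := by
  rw [map_add, rename_C, map_sum]
  simp only [map_mul, rename_C, rename_X]
  congr 1
  exact Fintype.sum_equiv e _ _ fun v => by simp

/-- The coefficient of `X v` in an affine normal form. [folklore] -/
theorem coeff_single_affine (c₀ : K) (c : Fin n × Fin n → K) (v : Fin n × Fin n) :
    coeff (Finsupp.single v 1) (C c₀ + ∑ w, C (c w) * X w) = c v := by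
  rw [coeff_add, coeff_C, if_neg (Finsupp.single_ne_zero.2 one_ne_zero).symm, zero_add, coeff_sum,
    Finset.sum_eq_single v]
  · rw [coeff_C_mul, coeff_X, if_pos rfl, mul_one]
  · intro b _ hb
    rw [coeff_C_mul, coeff_X, if_neg (fun h => hb (Finsupp.single_left_injective one_ne_zero h)), mul_zero]
  · intro h; exact absurd (Finset.mem_univ _) h

/-- An affine normal form is fixed by `rename e` iff its coefficient function is `e`-invariant. [folklore] -/
theorem rename_affine_eq_self_iff (e : Perm (Fin n × Fin n)) (c₀ : K) (c : Fin n × Fin n → K) :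
    rename e (C c₀ + ∑ v, C (c v) * X v) = C c₀ + ∑ v, C (c v) * X v ↔ ∀ v, c (e v) = c v := by
  rw [rename_affine]
  constructor
  · intro h v
    have := congrArg (coeff (Finsupp.single (e v) 1)) h
    rw [coeff_single_affine, coeff_single_affine] at this
    simpa using this.symm
  · intro h
    congr 1
    exact Finset.sum_congr rfl fun v _ => by rw [show c (e.symm v) = c v by simpa using (h (e.symm v)).symm]

/-- **AFFINE UPGRADE for a local action.**  A polynomial of total degree `≤ 1` fixed by every EVEN permutation fixing `Y` pointwise
(`|Y| + 4 ≤ n`) is fixed by EVERY permutation fixing `Y` pointwise: an odd permutation is corrected by a transposition of two free indices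
away from the coordinates of the position whose coefficient is compared. [folklore] -/
theorem symFix_of_altFix_affine {g : Perm (Fin n) →* Perm (Fin n × Fin n)} (hg : IsLocal g) {Y : Finset (Fin n)}
    (h4 : Y.card + 4 ≤ n) {q : MvPolynomial (Fin n × Fin n) K} (hq : q.totalDegree ≤ 1)
    (h : ∀ ρ : Perm (Fin n), (∀ x ∈ Y, ρ x = x) → Perm.sign ρ = 1 → vact (K := K) g ρ q = q) :
    ∀ ρ : Perm (Fin n), (∀ x ∈ Y, ρ x = x) → vact (K := K) g ρ q = q := by
  classical
  set c₀ := coeff 0 q with hc₀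
  set c : Fin n × Fin n → K := fun v => coeff (Finsupp.single v 1) q with hc
  have hqe : q = C c₀ + ∑ v, C (c v) * X v := HomogTools.eq_C_add_sum_of_totalDegree_le_one hq
  have hinv : ∀ ρ : Perm (Fin n), (∀ x ∈ Y, ρ x = x) → Perm.sign ρ = 1 → ∀ v, c (g ρ v) = c v := by
    intro ρ hρ hs
    have := h ρ hρ hs
    rw [vact_apply, hqe] at this
    exact (rename_affine_eq_self_iff (g ρ) c₀ c).1 this
  intro ρ hρ
  rw [vact_apply, hqe, rename_affine_eq_self_iff]
  intro v
  rcases Int.units_eq_one_or (Perm.sign ρ) with hs | hs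
  · exact hinv ρ hρ hs v
  · have hbig : 1 < (Finset.univ \ (Y ∪ {v.1, v.2})).card := by
      rw [Finset.card_sdiff_of_subset (Finset.subset_univ _), Finset.card_univ, Fintype.card_fin]
      have := (Finset.card_union_le Y {v.1, v.2}).trans (Nat.add_le_add_left (Finset.card_insert_le _ _) _)
      rw [Finset.card_singleton] at this
      omega
    obtain ⟨a, ha, b, hb, hab⟩ := Finset.one_lt_card.1 hbig
    simp only [Finset.mem_sdiff, Finset.mem_univ, Finset.mem_union, Finset.mem_insert, Finset.mem_singleton, true_and,
      not_or] at ha hb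
    set ρ' := ρ * swap a b with hρ'
    have hρ'Y : ∀ x ∈ Y, ρ' x = x := by
      intro x hx
      rw [hρ', Perm.mul_apply, swap_apply_of_ne_of_ne, hρ x hx]
      · rintro rfl; exact ha.1 hx
      · rintro rfl; exact hb.1 hx
    have hρ's : Perm.sign ρ' = 1 := by
      rw [hρ', Perm.sign_mul, Perm.sign_swap hab, hs]; decide
    have hloc : g ρ' v = g ρ v := hg ρ a b v ha.2.1 ha.2.2 hb.2.1 hb.2.2
    rw [← hloc]
    exact hinv ρ' hρ'Y hρ's v

/-! ### Characters of the symmetric group -/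

/-- **A multiplicative character of `Sym(Fin n)` with values in a field takes only the values `±1`** (transpositions square to `1`
and generate). [folklore] -/
theorem eq_one_or_eq_neg_one (χ : Perm (Fin n) → K) (h1 : χ 1 = 1) (hmul : ∀ a b, χ (a * b) = χ a * χ b) :
    ∀ ρ : Perm (Fin n), χ ρ = 1 ∨ χ ρ = -1 := by
  intro ρ
  induction ρ using Perm.swap_induction_on with
  | one => exact Or.inl h1
  | swap_mul f a b hab ih =>
    have hsw : χ (swap a b) = 1 ∨ χ (swap a b) = -1 := by
      have hsq : χ (swap a b) * χ (swap a b) = 1 := by rw [← hmul, swap_mul_self, h1]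
      have : (χ (swap a b) - 1) * (χ (swap a b) + 1) = 0 := by ring_nf; linear_combination hsq
      rcases mul_eq_zero.1 this with h | h
      · exact Or.inl (sub_eq_zero.1 h)
      · exact Or.inr (eq_neg_of_add_eq_zero_left h)
    rw [hmul]
    rcases hsw with h | h <;> rcases ih with h' | h' <;> simp [h, h']

end ProductAction

end Summit.ValiantsHypothesis.ValiantsHypothesis.Theorems

end
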